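import Summits.BirchSwinnertonDyer.BirchSwinnertonDyer.Theorems.KolyvaginRoadThreeFrameRigidity
import Summits.BirchSwinnertonDyer.Rank1Residual.X11b.BDPRouteOddPrimeClass
import Literature.NumberTheory.EllipticCurves.Rank1Residual.Typed.CasselsLowerBound
import Literature.NumberTheory.EllipticCurves.NeronIsogenyScalingHoldsProofs
import HarnessLib

/-!
# Route `KolyvaginRoadThree`, deciding crux `ZhangSharpFrameAtThreeHL` (item stmt-BirchSwinnertonDyer-19574):
# the crux is EXACTLY the class record's missing LOWER half on atom A1
# (cell `bsd-stepL`, seat `bsd-stepL-zhang3-p1` g4; `--supports stmt-BirchSwinnertonDyer-19574`, helper)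

THEOREMS ONLY (no definition, no named fact, no `sorry`); nothing about Kolyvagin's conjecture at `p = 3` and nothing
about `BSD(E,3)` is asserted; every published input is a named fact of the tree taken as a binder (the Néron-scaling
input of the class-level upper half is the tree THEOREM `integral_neronScaling_of_isGloballyMinimal_holds` and is
discharged). PARTITION: O2@3 (B10) × A1 (1 116 TRUE-OPEN classes; cw 248 943) — types-the-object-of; closes: none.

THE POINT. zhang3-p1 g3 proved (p431973 `zhangSharpFrameAtThreeHL_iff_bsdp_onA1`) that the deciding crux is, modulo
the route's published inputs, the leaf `BSDp W 3` on A1. Of the two halves of `BSDp` in Miller's currency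
(`Typed.MissingLowerBoundAt` = `ord₃ #Ш(E)_an ≤ ord₃ #Ш(E)`, the main-conjecture ∕ Eisenstein direction;
`Typed.MissingUpperBoundAt` = `ord₃ #Ш(E) ≤ ord₃ #Ш(E)_an`, the Euler-system direction) the UPPER half is already a
tree theorem on the whole of A1 from published inputs (multr1-p2's
`X11b.missingUpperBoundAt_of_classX11b_of_ram_of_not_dvd`: Kolyvagin 1990 over a Hoffstein–Luo field + Skinner 2016
Thm. C for the twist + Gross–Zagier). Hence, per curve and for the route item:

  `c₁(n) ≠ 0 for some Kolyvagin level n at one (equivalently every) HL frame of W ⟺ BSDp W 3 ⟺ MissingLowerBoundAt W 3`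
  `ZhangSharpFrameAtThreeHL ⟺ ∀ W ∈ A1, Typed.MissingLowerBoundAt W 3`            (all modulo PUB).

So Kolyvagin's conjecture mod 3 at `3 ∥ N` on the Hoffstein–Luo frames of A1 is LITERALLY the missing lower bound
`ord₃ #Ш(E)_an ≤ ord₃ #Ш(E)` for the 1 116 A1 classes — the same residual the class-record routes carry — and a mod-3
Kolyvagin witness at a curve is worth exactly that inequality there. Two per-curve currencies of the b2b lane follow
(§3): on an `E-K6` row (`#Ш(E)_an` a `3`-adic unit, 1 081 classes) the lower half is EMPTY, so the exact analytic
order of `Ш` alone (the lane's open admissibility question D-a) already yields a non-zero mod-3 Kolyvagin class on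
every HL frame WITHOUT any Heegner-point computation; on an `S-A` row (`ord₃ #Ш(E)_an ≤ 2`) a `3`-descent certificate
`3 ∣ #Ш(E)` does the same (Cassels–Tate squareness). Nothing is booked; no certificate is read here.

* `Koly.bsdp_three_iff_missingLowerBoundAt_onA1` — per curve: `BSDp W 3 ↔ MissingLowerBoundAt W 3` on A1;
* `Koly.kolyvaginClass_one_ne_zero_of_missingLowerBoundAt_of_hlFrame` — lower half ⟹ witness at every HL frame;
* `Koly.missingLowerBoundAt_of_kolyvaginClass_one_ne_zero_at_hlFrame` — one witness at one HL frame ⟹ lower half;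
* `Koly.kolyvaginClass_one_ne_zero_of_padicValRat_shaAn_le_zero_of_hlFrame` — E-K6 currency;
* `Koly.kolyvaginClass_one_ne_zero_of_shaAn_of_pow_dvd_shaOrder_of_hlFrame` — S-A currency (with Cassels–Tate);
* `Theorems.zhangSharpFrameAtThreeHL_iff_missingLowerBoundAt_onA1` — the route item.

References (locators only): [cite: WZhang2014, Thm. 1.1, Remark 5 and Thm. 10.2 (pp. 199, 245–246)]
[cite: McCallumLMS1991, §1 Theorem (Kolyvagin), §5 Cor. 5.6] [cite: Miller2011LMS, §1 and Def. 1.1]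
[cite: Skinner2016PacificMC, Thm. C (§1)] [cite: SilvermanAEC2009, Thm. X.4.14] [cite: HoffsteinLuo1997, main theorem].
-/

noncomputable section

open scoped Classical

namespace Summit.BirchSwinnertonDyer.Rank1Residual.X11b.Three.Koly

open WeierstrassCurve NumberField Literature.NumberTheory.EllipticCurves
  Literature.NumberTheory.EllipticCurves.ModularForms
  Literature.NumberTheory.EllipticCurves.Rank1Residual
  Literature.NumberTheory.EllipticCurves.Rank1Residual.Typed
  Summit.BirchSwinnertonDyer.Rank1Residual Summit.BirchSwinnertonDyer.Rank1Residual.X11b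

/-! ## §1 Per curve: on A1, `BSDp W 3` is its lower half -/

/-- **On an A1 curve the `3`-part of BSD is EXACTLY its lower half** `ord₃ #Ш(E)_an ≤ ord₃ #Ш(E)`: the upper half
is the tree theorem `X11b.missingUpperBoundAt_of_classX11b_of_ram_of_not_dvd` (Kolyvagin 1990 + Skinner 2016 Thm. C
+ Gross–Zagier over a Hoffstein–Luo field; published inputs as binders, Néron scaling discharged), and the two halves
make `BSDp` in analytic rank `1` (`X11b.bsdp_of_halves`). CONDITIONAL on every binder; nothing is booked.
[cite: Miller2011LMS, Def. 1.1] [cite: McCallumLMS1991, §1 Theorem (Kolyvagin)] [cite: Skinner2016PacificMC, Thm. C (§1)] -/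
theorem bsdp_three_iff_missingLowerBoundAt_onA1
    -- published inputs (named facts of the tree)
    (hGZ : ∀ (N : ℕ) [NeZero N] (W : WeierstrassCurve ℚ) (K : Type) [Field K] [NumberField K],
      gross_zagier N W K)
    (hKo : ∀ (N : ℕ) [NeZero N] (W : WeierstrassCurve ℚ) (K : Type) [Field K] [NumberField K],
      kolyvagin N W K)
    (hB : ∀ (N : ℕ) [NeZero N] (W : WeierstrassCurve ℚ) (K : Type) [Field K] [NumberField K],
      Kolyvagin1990_padicValNat_card_sha_le N W K)
    (hSk : Skinner2016.thmC_padicValRat_bsd_rank_zero)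
    (hGZK : rank_eq_analyticRank_of_analyticRank_le_one) (hmod : hasEntireLFunction_rat)
    (hnf : exists_isNewformOf) (hHL : HoffsteinLuo1997_exists_twist_L_one_ne_zero)
    (hMaz : mazur_not_dvd_maninConstant_of_odd)
    -- the pair (A1)
    (W : WeierstrassCurve ℚ) [W.IsElliptic] [W.IsGloballyMinimal]
    (hX : ClassX11b W 3) (hram : Ram W 3) (htam : ¬ 3 ∣ W.tamagawaProduct) :
    BSDp W 3 ↔ MissingLowerBoundAt W 3 := by
  haveI : Fact (Nat.Prime 3) := ⟨Nat.prime_three⟩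
  have hr : W.analyticRank ≤ 1 := le_of_eq hX.1
  haveI : Finite W.sha := (hGZK W hr).2
  refine ⟨fun hbsd ↦ (lower_and_upper_of_missingPPartAt W 3 (missingPPartAt_of_bsdp W 3 hbsd)).1, fun hlow ↦ ?_⟩
  exact bsdp_of_halves hGZK W 3 hr hlow
    (missingUpperBoundAt_of_classX11b_of_ram_of_not_dvd hGZ hKo hB hSk hGZK hmod hnf hHL hMaz
      integral_neronScaling_of_isGloballyMinimal_holds W 3 hX hram htam)

/-! ## §2 Per curve and frame: a mod-3 Kolyvagin witness is worth exactly the lower half -/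

/-- **The missing LOWER half at an A1 curve FORCES a non-zero mod-3 Kolyvagin class at every Hoffstein–Luo frame.**
Data: `W/ℚ` globally minimal with `(E,3) ∈ X11b`, a (ram) witness, `3 ∤ ∏_ℓ c_ℓ(E)`; `K` imaginary quadratic with
`d_K` odd, Heegner for `N_E`, `L(E^{d_K},1) ≠ 0`; a frame `(Dt, β, ι)` with `4N ∣ β² − d_K`, `3 ∤ c(Dt)`.
HYPOTHESIS: `Typed.MissingLowerBoundAt W 3` (`ord₃ #Ш(E)_an ≤ ord₃ #Ш(E)`). MECHANISM: §1 gives `BSDp W 3`, and zhang3-p1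
g3's `kolyvaginClass_one_ne_zero_of_bsdp_of_hlFrame` (W. Zhang 2014 Remark 5 ∕ Thm. 10.2 read backwards through
McCallum 1991 Cor. 5.6) gives the class. CONDITIONAL on every binder; nothing is booked.
[cite: WZhang2014, Remark 5 and Thm. 10.2] [cite: McCallumLMS1991, §5 Lemma 5.1 and Cor. 5.6] [cite: Miller2011LMS, Def. 1.1] -/
theorem kolyvaginClass_one_ne_zero_of_missingLowerBoundAt_of_hlFrame
    (W : WeierstrassCurve ℚ) [W.IsElliptic] [W.IsGloballyMinimal] [NeZero (W.conductorNorm ℤ)]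
    (K : Type) [Field K] [NumberField K]
    (Dt : ModularParametrizationData W (W.conductorNorm ℤ)) (β : ℤ) (ι : K →+* ℂ)
    -- published inputs (named facts of the tree)
    (hGZ : ∀ (N : ℕ) [NeZero N] (W : WeierstrassCurve ℚ) (K : Type) [Field K] [NumberField K],
      gross_zagier N W K)
    (hKo : ∀ (N : ℕ) [NeZero N] (W : WeierstrassCurve ℚ) (K : Type) [Field K] [NumberField K],
      kolyvagin N W K)
    (hB : ∀ (N : ℕ) [NeZero N] (W : WeierstrassCurve ℚ) (K : Type) [Field K] [NumberField K],
      Kolyvagin1990_padicValNat_card_sha_le N W K)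
    (hSk : Skinner2016.thmC_padicValRat_bsd_rank_zero)
    (hGZK : rank_eq_analyticRank_of_analyticRank_le_one) (hmod : hasEntireLFunction_rat)
    (hnf : exists_isNewformOf) (hHL : HoffsteinLuo1997_exists_twist_L_one_ne_zero)
    (hMaz : mazur_not_dvd_maninConstant_of_odd)
    (hrec : ∀ (N : ℕ) [NeZero N] (W : WeierstrassCurve ℚ) (K : Type) [Field K] [NumberField K],
      heegnerPointOfConductor_one_galoisConj N W K)
    (h1 : ∀ (N : ℕ) [NeZero N] (W : WeierstrassCurve ℚ) (K : Type) [Field K] [NumberField K],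
      phi_heegnerPointOfConductor_mem_range_map_ringClassField N W K)
    (h2 : ∀ (K : Type) [Field K] [NumberField K], exists_generator_ringClassGalOver K)
    (hMcU : McCallum1991_padicValNat_card_sha_primary_add_le_of_globalDivisibility)
    -- the pair (A1) and the HL frame
    (hX : ClassX11b W 3) (hram : Ram W 3) (htam : ¬ 3 ∣ W.tamagawaProduct)
    (hK : IsImaginaryQuadratic K) (hodd : Odd (NumberField.discr K))
    (hH : SatisfiesHeegnerHypothesis (W.conductorNorm ℤ) K)
    (hLt : (W.quadraticTwist (NumberField.discr K : ℚ)).entireLFunction 1 ≠ 0)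
    (hβ : (4 * (W.conductorNorm ℤ : ℤ)) ∣ β ^ 2 - NumberField.discr K) (hc : ¬ (3 : ℤ) ∣ Dt.c)
    -- the hypothesis: the lower half of the 3-part of BSD for E/ℚ
    (hlow : MissingLowerBoundAt W 3) :
    ∃ (n : ℕ) (d : KolyvaginHeegnerData Dt β ι n),
      KolyvaginDescent.KolSupp (Zhang2014.IsKolyvaginPrime (W.conductorNorm ℤ) W K 3) n ∧
        d.kolyvaginClass Nat.prime_three 1 ≠ 0 :=
  kolyvaginClass_one_ne_zero_of_bsdp_of_hlFrame W K Dt β ι (hGZ _ W K) (hKo _ W K) hSk hGZK hmod (hrec _ W K)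
    (h1 _ W K) (h2 K) hMcU hX hram htam hK hodd hH hLt hβ hc
    ((bsdp_three_iff_missingLowerBoundAt_onA1 hGZ hKo hB hSk hGZK hmod hnf hHL hMaz W hX hram htam).mpr hlow)

/-- **Conversely ONE non-zero mod-3 Kolyvagin class at ONE Hoffstein–Luo frame of an A1 curve gives the missing lower
half** `ord₃ #Ш(E)_an ≤ ord₃ #Ш(E)` at that curve: zhang3-p1 g3's end-to-end
`bsdp_three_of_kolyvaginClass_one_ne_zero_at_hlFrame` (the HL kernel at one frame: McCallum 1991 Cor. 5.6 in its
certificate half, Gross 1991 §3 for the tower data) gives `BSDp W 3`, whose lower half this is. This is the exchange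
rate of a per-pair Kolyvagin certificate in class-record currency. CONDITIONAL on every binder; nothing is booked.
[cite: McCallumLMS1991, §5 Cor. 5.6] [cite: WZhang2014, Thm. 1.1 and Remark 5] [cite: Miller2011LMS, Def. 1.1] -/
theorem missingLowerBoundAt_of_kolyvaginClass_one_ne_zero_at_hlFrame
    (W : WeierstrassCurve ℚ) [W.IsElliptic] [W.IsGloballyMinimal] [NeZero (W.conductorNorm ℤ)]
    (K : Type) [Field K] [NumberField K]
    (Dt : ModularParametrizationData W (W.conductorNorm ℤ)) (β : ℤ) (ι : K →+* ℂ)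
    -- published inputs (named facts of the tree)
    (hGZ : gross_zagier (W.conductorNorm ℤ) W K) (hKo : kolyvagin (W.conductorNorm ℤ) W K)
    (hB : Kolyvagin1990_padicValNat_card_sha_le (W.conductorNorm ℤ) W K)
    (hSk : Skinner2016.thmC_padicValRat_bsd_rank_zero)
    (hGZK : rank_eq_analyticRank_of_analyticRank_le_one) (hmod : hasEntireLFunction_rat)
    (hrec : heegnerPointOfConductor_one_galoisConj (W.conductorNorm ℤ) W K)
    (h1 : phi_heegnerPointOfConductor_mem_range_map_ringClassField (W.conductorNorm ℤ) W K)
    (h2 : exists_generator_ringClassGalOver K)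
    (hMc : McCallum1991_pow_dvd_card_sha_primary_of_certificate)
    -- the pair (A1) and the HL frame
    (hX : ClassX11b W 3) (hram : Ram W 3) (htam : ¬ 3 ∣ W.tamagawaProduct)
    (hK : IsImaginaryQuadratic K) (hodd : Odd (NumberField.discr K))
    (hH : SatisfiesHeegnerHypothesis (W.conductorNorm ℤ) K)
    (hLt : (W.quadraticTwist (NumberField.discr K : ℚ)).entireLFunction 1 ≠ 0)
    (hβ : (4 * (W.conductorNorm ℤ : ℤ)) ∣ β ^ 2 - NumberField.discr K) (hc : ¬ (3 : ℤ) ∣ Dt.c)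
    -- ONE non-zero mod-3 Kolyvagin class on the frame
    {n : ℕ} (d : KolyvaginHeegnerData Dt β ι n)
    (hn : KolyvaginDescent.KolSupp (Zhang2014.IsKolyvaginPrime (W.conductorNorm ℤ) W K 3) n)
    (hne : d.kolyvaginClass Nat.prime_three 1 ≠ 0) :
    MissingLowerBoundAt W 3 := by
  haveI : Fact (Nat.Prime 3) := ⟨Nat.prime_three⟩
  haveI : Finite W.sha := (hGZK W (le_of_eq hX.1)).2
  exact (lower_and_upper_of_missingPPartAt W 3 (missingPPartAt_of_bsdp W 3
    (bsdp_three_of_kolyvaginClass_one_ne_zero_at_hlFrame W K Dt β ι hGZ hKo hB hSk hGZK hmod hrec h1 h2 hMc hX hram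
      htam hK hodd hH hLt hβ hc d hn hne))).1

/-! ## §3 The two per-curve currencies of the class-record lane -/

/-- **E-K6 currency (`#Ш(E)_an` a `3`-adic unit): the exact analytic order of `Ш` alone yields a non-zero mod-3
Kolyvagin class at every Hoffstein–Luo frame** — for then the lower half `ord₃ #Ш(E)_an ≤ ord₃ #Ш(E)` is empty
(`ord₃ q ≤ 0 ≤ ord₃ #Ш`). This is the currency of the b2b lane's consumer
`X11b.bsdp_of_classX11b_of_ram_of_padicValRat_shaAn_le` (its `hq`, `hv`): no Heegner point of conductor `> 1` is
computed. CONDITIONAL on every binder (in particular on the exactness of `hq`); nothing is booked.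
[cite: WZhang2014, Remark 5 and Thm. 10.2] [cite: Miller2011LMS, Def. 1.1] -/
theorem kolyvaginClass_one_ne_zero_of_padicValRat_shaAn_le_zero_of_hlFrame
    (W : WeierstrassCurve ℚ) [W.IsElliptic] [W.IsGloballyMinimal] [NeZero (W.conductorNorm ℤ)]
    (K : Type) [Field K] [NumberField K]
    (Dt : ModularParametrizationData W (W.conductorNorm ℤ)) (β : ℤ) (ι : K →+* ℂ)
    -- published inputs (named facts of the tree)
    (hGZ : ∀ (N : ℕ) [NeZero N] (W : WeierstrassCurve ℚ) (K : Type) [Field K] [NumberField K],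
      gross_zagier N W K)
    (hKo : ∀ (N : ℕ) [NeZero N] (W : WeierstrassCurve ℚ) (K : Type) [Field K] [NumberField K],
      kolyvagin N W K)
    (hB : ∀ (N : ℕ) [NeZero N] (W : WeierstrassCurve ℚ) (K : Type) [Field K] [NumberField K],
      Kolyvagin1990_padicValNat_card_sha_le N W K)
    (hSk : Skinner2016.thmC_padicValRat_bsd_rank_zero)
    (hGZK : rank_eq_analyticRank_of_analyticRank_le_one) (hmod : hasEntireLFunction_rat)
    (hnf : exists_isNewformOf) (hHL : HoffsteinLuo1997_exists_twist_L_one_ne_zero)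
    (hMaz : mazur_not_dvd_maninConstant_of_odd)
    (hrec : ∀ (N : ℕ) [NeZero N] (W : WeierstrassCurve ℚ) (K : Type) [Field K] [NumberField K],
      heegnerPointOfConductor_one_galoisConj N W K)
    (h1 : ∀ (N : ℕ) [NeZero N] (W : WeierstrassCurve ℚ) (K : Type) [Field K] [NumberField K],
      phi_heegnerPointOfConductor_mem_range_map_ringClassField N W K)
    (h2 : ∀ (K : Type) [Field K] [NumberField K], exists_generator_ringClassGalOver K)
    (hMcU : McCallum1991_padicValNat_card_sha_primary_add_le_of_globalDivisibility)
    -- the pair (A1) and the HL frame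
    (hX : ClassX11b W 3) (hram : Ram W 3) (htam : ¬ 3 ∣ W.tamagawaProduct)
    (hK : IsImaginaryQuadratic K) (hodd : Odd (NumberField.discr K))
    (hH : SatisfiesHeegnerHypothesis (W.conductorNorm ℤ) K)
    (hLt : (W.quadraticTwist (NumberField.discr K : ℚ)).entireLFunction 1 ≠ 0)
    (hβ : (4 * (W.conductorNorm ℤ : ℤ)) ∣ β ^ 2 - NumberField.discr K) (hc : ¬ (3 : ℤ) ∣ Dt.c)
    -- the datum: the exact analytic order of Ш is a 3-adic unit (or has a 3 in the denominator)
    {q : ℚ} (hq : shaAn W = (q : ℂ)) (hv : padicValRat 3 q ≤ 0) :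
    ∃ (n : ℕ) (d : KolyvaginHeegnerData Dt β ι n),
      KolyvaginDescent.KolSupp (Zhang2014.IsKolyvaginPrime (W.conductorNorm ℤ) W K 3) n ∧
        d.kolyvaginClass Nat.prime_three 1 ≠ 0 :=
  kolyvaginClass_one_ne_zero_of_missingLowerBoundAt_of_hlFrame W K Dt β ι hGZ hKo hB hSk hGZK hmod hnf hHL hMaz hrec
    h1 h2 hMcU hX hram htam hK hodd hH hLt hβ hc ⟨q, hq, hv.trans (by exact_mod_cast Nat.zero_le _)⟩

/-- **S-A currency (`ord₃ #Ш(E)_an ≤ 2k` with a descent certificate `3^{2k-1} ∣ #Ш(E)`): a non-zero mod-3 Kolyvagin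
class at every Hoffstein–Luo frame** — Cassels–Tate squareness (`hCT`, bsd.S18; `Ш(E)` finite by GZK in analytic
rank `1`) turns the certificate into `3^{2k} ∣ #Ш(E)`, i.e. into the lower half
(`Typed.missingLowerBoundAt_of_casselsTate_of_pow_dvd`), and §2 applies. At `k = 1` this is the shape of the 35 A1
rows with `#Ш(E)_an = 9`: a `3`-descent exhibiting ONE element of order `3` in `Ш(E/ℚ)` is worth a mod-3 Kolyvagin
witness (there necessarily of level `ω(n) ≥ 2`, koly's THEOREM P). The certificate is a BINDER here, never read or
proved in this file. CONDITIONAL on every binder; nothing is booked.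
[cite: SilvermanAEC2009, Thm. X.4.14] [cite: WZhang2014, Remark 5 and Thm. 10.2] [cite: Miller2011LMS, Def. 1.1] -/
theorem kolyvaginClass_one_ne_zero_of_shaAn_of_pow_dvd_shaOrder_of_hlFrame
    (W : WeierstrassCurve ℚ) [W.IsElliptic] [W.IsGloballyMinimal] [NeZero (W.conductorNorm ℤ)]
    (K : Type) [Field K] [NumberField K]
    (Dt : ModularParametrizationData W (W.conductorNorm ℤ)) (β : ℤ) (ι : K →+* ℂ)
    -- published inputs (named facts of the tree)
    (hCT : exists_casselsTate_pairing (K := ℚ))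
    (hGZ : ∀ (N : ℕ) [NeZero N] (W : WeierstrassCurve ℚ) (K : Type) [Field K] [NumberField K],
      gross_zagier N W K)
    (hKo : ∀ (N : ℕ) [NeZero N] (W : WeierstrassCurve ℚ) (K : Type) [Field K] [NumberField K],
      kolyvagin N W K)
    (hB : ∀ (N : ℕ) [NeZero N] (W : WeierstrassCurve ℚ) (K : Type) [Field K] [NumberField K],
      Kolyvagin1990_padicValNat_card_sha_le N W K)
    (hSk : Skinner2016.thmC_padicValRat_bsd_rank_zero)
    (hGZK : rank_eq_analyticRank_of_analyticRank_le_one) (hmod : hasEntireLFunction_rat)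
    (hnf : exists_isNewformOf) (hHL : HoffsteinLuo1997_exists_twist_L_one_ne_zero)
    (hMaz : mazur_not_dvd_maninConstant_of_odd)
    (hrec : ∀ (N : ℕ) [NeZero N] (W : WeierstrassCurve ℚ) (K : Type) [Field K] [NumberField K],
      heegnerPointOfConductor_one_galoisConj N W K)
    (h1 : ∀ (N : ℕ) [NeZero N] (W : WeierstrassCurve ℚ) (K : Type) [Field K] [NumberField K],
      phi_heegnerPointOfConductor_mem_range_map_ringClassField N W K)
    (h2 : ∀ (K : Type) [Field K] [NumberField K], exists_generator_ringClassGalOver K)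
    (hMcU : McCallum1991_padicValNat_card_sha_primary_add_le_of_globalDivisibility)
    -- the pair (A1) and the HL frame
    (hX : ClassX11b W 3) (hram : Ram W 3) (htam : ¬ 3 ∣ W.tamagawaProduct)
    (hK : IsImaginaryQuadratic K) (hodd : Odd (NumberField.discr K))
    (hH : SatisfiesHeegnerHypothesis (W.conductorNorm ℤ) K)
    (hLt : (W.quadraticTwist (NumberField.discr K : ℚ)).entireLFunction 1 ≠ 0)
    (hβ : (4 * (W.conductorNorm ℤ : ℤ)) ∣ β ^ 2 - NumberField.discr K) (hc : ¬ (3 : ℤ) ∣ Dt.c)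
    -- the data: the exact analytic order of Ш up to 3^{2k}, and a descent certificate 3^{2k-1} ∣ #Ш(E/ℚ)
    {q : ℚ} (hq : shaAn W = (q : ℂ)) {k : ℕ} (hv : padicValRat 3 q ≤ 2 * k)
    (hdvd : 3 ^ (2 * k - 1) ∣ W.shaOrder) :
    ∃ (n : ℕ) (d : KolyvaginHeegnerData Dt β ι n),
      KolyvaginDescent.KolSupp (Zhang2014.IsKolyvaginPrime (W.conductorNorm ℤ) W K 3) n ∧
        d.kolyvaginClass Nat.prime_three 1 ≠ 0 := by
  haveI : Fact (Nat.Prime 3) := ⟨Nat.prime_three⟩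
  have hfin : W.ShaFinite := (hGZK W (le_of_eq hX.1)).2
  exact kolyvaginClass_one_ne_zero_of_missingLowerBoundAt_of_hlFrame W K Dt β ι hGZ hKo hB hSk hGZK hmod hnf hHL
    hMaz hrec h1 h2 hMcU hX hram htam hK hodd hH hLt hβ hc
    (missingLowerBoundAt_of_casselsTate_of_pow_dvd W 3 hCT hfin hq hv hdvd)

end Summit.BirchSwinnertonDyer.Rank1Residual.X11b.Three.Koly

/-! ## §4 The route item: the deciding crux is the missing lower half on A1 -/

namespace Summit.BirchSwinnertonDyer.BirchSwinnertonDyer.Theorems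

open WeierstrassCurve Literature.NumberTheory.EllipticCurves Literature.NumberTheory.EllipticCurves.ModularForms
  Literature.NumberTheory.EllipticCurves.Rank1Residual Literature.NumberTheory.EllipticCurves.Rank1Residual.Typed
  Summit.BirchSwinnertonDyer.Rank1Residual Summit.BirchSwinnertonDyer.Rank1Residual.X11b
  Summit.BirchSwinnertonDyer.BirchSwinnertonDyer.Theses.KolyvaginRoadThree

/-- **THE DECIDING CRUX IS THE MISSING LOWER HALF ON A1.** Modulo the published inputs of the route (all binders:
Gross–Zagier, Kolyvagin ×2, Skinner 2016 Thm. C, GZK, modularity, newforms, Hoffstein–Luo, Mazur's Manin constant,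
Shimura reciprocity at conductor 1, McCallum 1991 Cor. 5.6 in both halves, Gross 1991 §3 ×2), the deciding crux of
`route-BirchSwinnertonDyer-KolyvaginRoadThree` is EQUIVALENT to the main-conjecture half of the class record on its atom:
`ZhangSharpFrameAtThreeHL ↔ ∀ W, ClassX11b W 3 → Ram W 3 → ¬ 3 ∣ W.tamagawaProduct → Typed.MissingLowerBoundAt W 3`
(`ord₃ #Ш(E)_an ≤ ord₃ #Ш(E)` for every A1 curve). The Euler-system half is NOT part of the crux: it is in print on all
of A1. zhang3-p1 g3's `zhangSharpFrameAtThreeHL_iff_bsdp_onA1` composed with §1. CONDITIONAL on every binder; nothing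
is booked; BSD is proved for no curve here. [cite: WZhang2014, Thm. 1.1, Remark 5 and Thm. 10.2]
[cite: McCallumLMS1991, §1 Theorem and §5 Cor. 5.6] [cite: Miller2011LMS, Def. 1.1] -/
theorem zhangSharpFrameAtThreeHL_iff_missingLowerBoundAt_onA1
    (hGZ : ∀ (N : ℕ) [NeZero N] (W : WeierstrassCurve ℚ) (K : Type) [Field K] [NumberField K],
      gross_zagier N W K)
    (hKo : ∀ (N : ℕ) [NeZero N] (W : WeierstrassCurve ℚ) (K : Type) [Field K] [NumberField K],
      kolyvagin N W K)
    (hB : ∀ (N : ℕ) [NeZero N] (W : WeierstrassCurve ℚ) (K : Type) [Field K] [NumberField K],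
      Kolyvagin1990_padicValNat_card_sha_le N W K)
    (hSk : Skinner2016.thmC_padicValRat_bsd_rank_zero)
    (hGZK : rank_eq_analyticRank_of_analyticRank_le_one) (hmod : hasEntireLFunction_rat)
    (hnf : exists_isNewformOf) (hHL : HoffsteinLuo1997_exists_twist_L_one_ne_zero)
    (hMaz : mazur_not_dvd_maninConstant_of_odd)
    (hrec : ∀ (N : ℕ) [NeZero N] (W : WeierstrassCurve ℚ) (K : Type) [Field K] [NumberField K],
      heegnerPointOfConductor_one_galoisConj N W K)
    (hMc : McCallum1991_pow_dvd_card_sha_primary_of_certificate)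
    (hMcU : McCallum1991_padicValNat_card_sha_primary_add_le_of_globalDivisibility)
    (h1 : ∀ (N : ℕ) [NeZero N] (W : WeierstrassCurve ℚ) (K : Type) [Field K] [NumberField K],
      phi_heegnerPointOfConductor_mem_range_map_ringClassField N W K)
    (h2 : ∀ (K : Type) [Field K] [NumberField K], exists_generator_ringClassGalOver K) :
    ZhangSharpFrameAtThreeHL ↔
      ∀ (W : WeierstrassCurve ℚ) [W.IsElliptic] [W.IsGloballyMinimal],
        ClassX11b W 3 → Ram W 3 → ¬ 3 ∣ W.tamagawaProduct → MissingLowerBoundAt W 3 := by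
  rw [zhangSharpFrameAtThreeHL_iff_bsdp_onA1 hGZ hKo hB hSk hGZK hmod hnf hHL hMaz hrec hMc hMcU h1 h2]
  refine ⟨fun h W _ _ hX hram htam ↦ ?_, fun h W _ _ hX hram htam ↦ ?_⟩
  · exact (Summit.BirchSwinnertonDyer.Rank1Residual.X11b.Three.Koly.bsdp_three_iff_missingLowerBoundAt_onA1 hGZ hKo
      hB hSk hGZK hmod hnf hHL hMaz W hX hram htam).mp (h W hX hram htam)
  · exact (Summit.BirchSwinnertonDyer.Rank1Residual.X11b.Three.Koly.bsdp_three_iff_missingLowerBoundAt_onA1 hGZ hKo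
      hB hSk hGZK hmod hnf hHL hMaz W hX hram htam).mpr (h W hX hram htam)

end Summit.BirchSwinnertonDyer.BirchSwinnertonDyer.Theorems

end
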